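import Mathlib.Analysis.Calculus.LineDeriv.IntegrationByParts
import Mathlib.Analysis.SpecialFunctions.JapaneseBracket
import Mathlib.Analysis.SpecialFunctions.ExpDeriv
import Mathlib.Analysis.Complex.RealDeriv
import Mathlib.MeasureTheory.Measure.Haar.OfBasis
import Mathlib.LinearAlgebra.Matrix.NonsingularInverse
import Mathlib.Analysis.SpecialFunctions.Gaussian.GaussianIntegral
import HarnessLib

/-!
# Complex Gaussian integrals on `ℂ^Λ` by integration by parts:
# `∫ φ̄_a φ_b e^{-φBφ̄} = (B⁻¹)_{a,b} ∫ e^{-φBφ̄}` ([BIS09], §2.1)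

First file of the bosonic–fermionic ("supersymmetric") Gaussian integration behind Proposition 3.1
of Bauerschmidt–Brydges–Slade, CMP 337 (2015), arXiv:1403.7422 — the integral representation
`G_{N,g,ν}(a,b) = ∫ e^{-Σ_x(τ_{Δ,x} + gτ_x² + ντ_x)} φ̄_a φ_b` of the weakly self-avoiding walk
two-point function, "proved in [BEI92, BI03d]; see [BIS09] for a self-contained proof". We follow
[BIS09] = Brydges–Imbrie–Slade, *Functional integral representations for self-avoiding walk*,
Probab. Surveys 6 (2009), arXiv:0906.0922, whose §2.1 treats the purely BOSONIC Gaussian integrals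
on `ℂ^Λ ≅ ℝ^{2|Λ|}` for a complex matrix with positive Hermitian part: Lemma 2.1
(`Z_C = (2πi)^{|Λ|}/det A`, by diagonalisation and analytic continuation), Lemma 2.2 (integration
by parts, `∫ φ̄_a F dμ_C = Σ_x C_{a,x} ∫ ∂F/∂φ_x dμ_C`) and (2.11) (`∫ φ̄_a φ_b dμ_C = C_{a,b}`).

This file proves the integration-by-parts half on `ℂ^Λ` for a GENERAL finite index type `Λ`,
deliberately avoiding the evaluation of `Z_C` (Lemma 2.1's analytic continuation): the covariance
identity is obtained in the unnormalised form `∫ φ̄_a φ_b e^{-φBφ̄} = (B⁻¹)_{a,b} ∫ e^{-φBφ̄}`, which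
is what the self-normalising mixed bosonic–fermionic expectation of §4 needs.

* `quadForm B φ = φBφ̄ = Σ φ_x B_{xy} φ̄_y`, `gaussWeight B φ = e^{-φBφ̄}`, the Wirtinger gradients
  `gradPhi` (`(Bφ̄)_x = ∂(φBφ̄)/∂φ_x`) and `gradPhiBar` (`(φB)_x = ∂/∂φ̄_x`);
* real differential calculus on `ℂ^Λ` (`coordCLM`, `conjCoordCLM`, `hasFDerivAt_quadForm`,
  `quadFormDeriv_apply`: `∂_v(φBφ̄) = Σ_x(v_x(Bφ̄)_x + v̄_x(φB)_x)`, `hasFDerivAt_gaussWeight`,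
  `fderiv_gaussWeight_apply`: `∂_v e^{-φBφ̄} = -∂_v(φBφ̄) e^{-φBφ̄}`);
* positive Hermitian part, quantified as `Re φBφ̄ ≥ c Σ_x|φ_x|²` (`c > 0`): Gaussian domination
  `norm_gaussWeight_le` (`|e^{-φBφ̄}| ≤ e^{-c‖φ‖²}`), `one_add_pow_mul_exp_neg_le`,
  `integrable_one_add_norm_pow_mul_exp_neg` (`(1+‖φ‖)^k e^{-c‖φ‖²} ∈ L¹(ℂ^Λ)`, from Mathlib's
  Japanese bracket `integrable_one_add_norm`), **`integrable_mul_gaussWeight`** (polynomially bounded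
  `F` times the weight is integrable) and `isUnit_of_re_quadForm_ge` (`B` is invertible);
* **`integral_mul_quadFormDeriv_mul_gaussWeight`** — integration by parts without boundary terms,
  `∫ F ∂_v(φBφ̄) e^{-φBφ̄} = ∫ (∂_vF) e^{-φBφ̄}` for every real direction `v` (Mathlib's
  `integral_mul_fderiv_eq_neg_fderiv_mul_of_integrable` on the finite-dimensional real space `ℂ^Λ`
  with its Haar = Lebesgue measure), and its Wirtinger form
  **`integral_coord_mul_gradPhi_mul_gaussWeight`**: `∫ φ_b (Bφ̄)_x e^{-φBφ̄} = δ_{x,b} ∫ e^{-φBφ̄}`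
  (`∂/∂φ_x = ½(∂_{e_x} - i∂_{ie_x})`, `∂φ_b/∂φ_x = δ_{x,b}`);
* `partitionFn B = Z_B = ∫ e^{-φBφ̄}`, `twoPointFn B a b = ∫ φ̄_a φ_b e^{-φBφ̄}`,
  `sum_mul_twoPointFn` (`Σ_y B_{xy} ∫φ̄_yφ_b e^{-φBφ̄} = δ_{xb} Z_B`) and
  **`twoPointFn_eq`: `∫ φ̄_a φ_b e^{-φBφ̄} = (B⁻¹)_{a,b} Z_B`** — eq. (2.11) of [BIS09] in unnormalised
  form.

Measure: Mathlib's `volume` on `Λ → ℂ` (product of Lebesgue measure on `ℂ = ℝ²`), i.e.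
`Π_x du_x dv_x`; the source's `Π_x dφ̄_x dφ_x = (2i)^{|Λ|} Π du dv` differs by a constant that
cancels in every statement here.
-/

noncomputable section

open MeasureTheory Filter Topology Set Complex ComplexConjugate
open scoped BigOperators

namespace Literature.Barriers.CriticalPhenomena

namespace CTWSAW

namespace Boson

variable {Λ : Type*}

section Coordinates

/-! ### Real differential calculus on `ℂ^Λ`: coordinates -/

/-- The coordinate `φ ↦ φ_x` as a real-linear map. [folklore] -/
def coordCLM (x : Λ) : (Λ → ℂ) →L[ℝ] ℂ := (ContinuousLinearMap.proj (R := ℂ) x).restrictScalars ℝ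

/-- The conjugate coordinate `φ ↦ φ̄_x` as a real-linear map. [folklore] -/
def conjCoordCLM (x : Λ) : (Λ → ℂ) →L[ℝ] ℂ :=
  (Complex.conjCLE : ℂ →L[ℝ] ℂ).comp (coordCLM x)

/-- `coordCLM x v = v_x`. [folklore] -/
@[simp] theorem coordCLM_apply (x : Λ) (v : Λ → ℂ) : coordCLM x v = v x := rfl

/-- `conjCoordCLM x v = v̄_x`. [folklore] -/
@[simp] theorem conjCoordCLM_apply (x : Λ) (v : Λ → ℂ) : conjCoordCLM x v = conj (v x) := rfl

/-- `φ ↦ φ_x` is real-differentiable with derivative `v ↦ v_x`. [folklore] -/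
theorem hasFDerivAt_coord (x : Λ) (φ : Λ → ℂ) :
    HasFDerivAt (fun φ : Λ → ℂ => φ x) (coordCLM x) φ :=
  (coordCLM x).hasFDerivAt

/-- `φ ↦ φ̄_x` is real-differentiable with derivative `v ↦ v̄_x`. [folklore] -/
theorem hasFDerivAt_conjCoord (x : Λ) (φ : Λ → ℂ) :
    HasFDerivAt (fun φ : Λ → ℂ => conj (φ x)) (conjCoordCLM x) φ :=
  (conjCoordCLM x).hasFDerivAt

/-- Directional derivative of the coordinate `φ_b`: `∂_v φ_b = v_b`. [folklore] -/
theorem fderiv_coord_apply (b : Λ) (φ v : Λ → ℂ) :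
    fderiv ℝ (fun φ : Λ → ℂ => φ b) φ v = v b := by
  rw [(hasFDerivAt_coord b φ).fderiv]; rfl

end Coordinates

variable [Fintype Λ]

/-! ### The quadratic form `φBφ̄` and its Wirtinger gradients -/

/-- `φBφ̄ = Σ_{x,y} φ_x B_{x,y} φ̄_y` for a complex matrix `B` (the bosonic part of the action
`S_B`). [cite: BrydgesImbrieSlade2009, §2.1 (φAφ̄)] -/
def quadForm (B : Matrix Λ Λ ℂ) (φ : Λ → ℂ) : ℂ := ∑ x, ∑ y, φ x * B x y * conj (φ y)

/-- The bosonic Gaussian weight `e^{-φBφ̄}`. [cite: BrydgesImbrieSlade2009, §2.1, eq. defining dμ_C] -/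
def gaussWeight (B : Matrix Λ Λ ℂ) (φ : Λ → ℂ) : ℂ := cexp (-quadForm B φ)

/-- `(Bφ̄)_x = Σ_y B_{x,y} φ̄_y = ∂(φBφ̄)/∂φ_x`. [cite: BrydgesImbrieSlade2009, §2.1, proof of Lemma 2.2] -/
def gradPhi (B : Matrix Λ Λ ℂ) (φ : Λ → ℂ) (x : Λ) : ℂ := ∑ y, B x y * conj (φ y)

/-- `(φB)_x = Σ_y φ_y B_{y,x} = ∂(φBφ̄)/∂φ̄_x`. [folklore] -/
def gradPhiBar (B : Matrix Λ Λ ℂ) (φ : Λ → ℂ) (x : Λ) : ℂ := ∑ y, φ y * B y x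

/-- `φBφ̄ = Σ_x φ_x (Bφ̄)_x`. [folklore] -/
theorem quadForm_eq_sum_gradPhi (B : Matrix Λ Λ ℂ) (φ : Λ → ℂ) :
    quadForm B φ = ∑ x, φ x * gradPhi B φ x := by
  simp only [quadForm, gradPhi, Finset.mul_sum, mul_assoc]

/-- The real derivative of `φBφ̄` at `φ`: `v ↦ Σ_{x,y} (v_x B_{xy} φ̄_y + φ_x B_{xy} v̄_y)`. [folklore] -/
def quadFormDeriv (B : Matrix Λ Λ ℂ) (φ : Λ → ℂ) : (Λ → ℂ) →L[ℝ] ℂ :=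
  ∑ x, ∑ y, ((B x y * conj (φ y)) • coordCLM x + (φ x * B x y) • conjCoordCLM y)

/-- `∂_v(φBφ̄) = Σ_x (v_x (Bφ̄)_x + v̄_x (φB)_x)`. [folklore] -/
theorem quadFormDeriv_apply (B : Matrix Λ Λ ℂ) (φ v : Λ → ℂ) :
    quadFormDeriv B φ v = ∑ x, (v x * gradPhi B φ x + conj (v x) * gradPhiBar B φ x) := by
  have h1 : quadFormDeriv B φ v = ∑ x, ∑ y, (B x y * conj (φ y) * v x + φ x * B x y * conj (v y)) := by
    simp [quadFormDeriv]
  rw [h1]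
  simp only [gradPhi, gradPhiBar, Finset.mul_sum, Finset.sum_add_distrib]
  congr 1
  · exact Finset.sum_congr rfl fun x _ => Finset.sum_congr rfl fun y _ => by ring
  · rw [Finset.sum_comm]
    exact Finset.sum_congr rfl fun x _ => Finset.sum_congr rfl fun y _ => by ring

/-- `φBφ̄` is real-differentiable. [folklore] -/
theorem hasFDerivAt_quadForm (B : Matrix Λ Λ ℂ) (φ : Λ → ℂ) :
    HasFDerivAt (quadForm B) (quadFormDeriv B φ) φ := by
  unfold quadForm quadFormDeriv
  refine HasFDerivAt.fun_sum fun x _ => HasFDerivAt.fun_sum fun y _ => ?_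
  have h1 := ((hasFDerivAt_coord x φ).mul_const (B x y)).mul (hasFDerivAt_conjCoord y φ)
  refine h1.congr_fderiv ?_
  ext v
  simp [smul_eq_mul]
  ring

/-- The bosonic weight is real-differentiable with derivative `-e^{-φBφ̄} (φBφ̄)'`. [folklore] -/
theorem hasFDerivAt_gaussWeight (B : Matrix Λ Λ ℂ) (φ : Λ → ℂ) :
    HasFDerivAt (gaussWeight B) (-(gaussWeight B φ) • quadFormDeriv B φ) φ := by
  have h : HasFDerivAt (gaussWeight B) (cexp (-quadForm B φ) • -quadFormDeriv B φ) φ :=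
    (hasFDerivAt_quadForm B φ).neg.cexp
  refine h.congr_fderiv ?_
  rw [smul_neg, ← neg_smul]
  rfl

/-- Directional derivatives of the weight: `∂_v e^{-φBφ̄} = -(∂_v φBφ̄) e^{-φBφ̄}`. [folklore] -/
theorem fderiv_gaussWeight_apply (B : Matrix Λ Λ ℂ) (φ v : Λ → ℂ) :
    fderiv ℝ (gaussWeight B) φ v = -(gaussWeight B φ * quadFormDeriv B φ v) := by
  rw [(hasFDerivAt_gaussWeight B φ).fderiv]
  simp [smul_eq_mul]

/-! ### Positive Hermitian part: Gaussian domination and integrability -/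

variable {B : Matrix Λ Λ ℂ} {c : ℝ}

/-- `‖e^{-φBφ̄}‖ = e^{-Re φBφ̄}`. [folklore] -/
theorem norm_gaussWeight (B : Matrix Λ Λ ℂ) (φ : Λ → ℂ) :
    ‖gaussWeight B φ‖ = Real.exp (-(quadForm B φ).re) := by
  rw [gaussWeight, Complex.norm_exp, neg_re]

/-- Under `Re φBφ̄ ≥ c Σ|φ_x|²`: `‖e^{-φBφ̄}‖ ≤ e^{-c‖φ‖²}` (sup norm). [folklore] -/
theorem norm_gaussWeight_le (hc : 0 ≤ c) (hB : ∀ φ, c * ∑ x, ‖φ x‖ ^ 2 ≤ (quadForm B φ).re)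
    (φ : Λ → ℂ) : ‖gaussWeight B φ‖ ≤ Real.exp (-(c * ‖φ‖ ^ 2)) := by
  rw [norm_gaussWeight]
  refine Real.exp_le_exp.2 (neg_le_neg (le_trans ?_ (hB φ)))
  refine mul_le_mul_of_nonneg_left ?_ hc
  -- `‖φ‖² ≤ Σ_x ‖φ_x‖²` for the sup norm
  have hs : 0 ≤ ∑ x, ‖φ x‖ ^ 2 := Finset.sum_nonneg fun x _ => sq_nonneg _
  have h : ‖φ‖ ≤ Real.sqrt (∑ x, ‖φ x‖ ^ 2) := by
    refine (pi_norm_le_iff_of_nonneg (Real.sqrt_nonneg _)).2 fun x => ?_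
    rw [← Real.sqrt_sq (norm_nonneg (φ x))]
    exact Real.sqrt_le_sqrt (Finset.single_le_sum (fun y _ => sq_nonneg ‖φ y‖) (Finset.mem_univ x))
  calc ‖φ‖ ^ 2 ≤ (Real.sqrt (∑ x, ‖φ x‖ ^ 2)) ^ 2 := by gcongr
    _ = ∑ x, ‖φ x‖ ^ 2 := Real.sq_sqrt hs

/-- `(1+s)^m e^{-cs²} ≤ 2^m max(1, m!/c^m)`-type bound: `(1 + s)^m e^{-c s²} ≤ K` for `s ≥ 0`.
[folklore] -/
theorem one_add_pow_mul_exp_neg_le (hc : 0 < c) (m : ℕ) :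
    ∃ K : ℝ, 0 < K ∧ ∀ s : ℝ, 0 ≤ s → (1 + s) ^ m * Real.exp (-(c * s ^ 2)) ≤ K := by
  refine ⟨2 ^ m * (1 + (m.factorial : ℝ) / c ^ m), by positivity, fun s hs => ?_⟩
  have hfc : 0 ≤ (m.factorial : ℝ) / c ^ m := by positivity
  have hexp1 : Real.exp (-(c * s ^ 2)) ≤ 1 := by
    rw [Real.exp_le_one_iff]; nlinarith [sq_nonneg s]
  rcases le_or_gt s 1 with hs1 | hs1
  · calc (1 + s) ^ m * Real.exp (-(c * s ^ 2)) ≤ 2 ^ m * 1 :=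
          mul_le_mul (pow_le_pow_left₀ (by linarith) (by linarith) m) hexp1
            (Real.exp_pos _).le (by positivity)
      _ ≤ 2 ^ m * (1 + (m.factorial : ℝ) / c ^ m) :=
          mul_le_mul_of_nonneg_left (by linarith) (by positivity)
  · -- `s > 1`: `(1+s)^m ≤ (2s)^m` and `s^m e^{-cs²} ≤ s^{2m} e^{-cs²} ≤ m!/c^m`
    have h1 : (1 + s) ^ m ≤ (2 * s) ^ m := pow_le_pow_left₀ (by linarith) (by linarith) m
    have h2 : (c * s ^ 2) ^ m / m.factorial ≤ Real.exp (c * s ^ 2) :=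
      Real.pow_div_factorial_le_exp _ (by positivity) m
    have h2' : c ^ m * s ^ (2 * m) ≤ Real.exp (c * s ^ 2) * m.factorial := by
      have := (div_le_iff₀ (by positivity)).1 h2
      rwa [mul_pow, ← pow_mul] at this
    have hexp : 0 < Real.exp (c * s ^ 2) := Real.exp_pos _
    have h3 : s ^ m * Real.exp (-(c * s ^ 2)) ≤ (m.factorial : ℝ) / c ^ m := by
      have hsm : s ^ m ≤ s ^ (2 * m) := pow_le_pow_right₀ hs1.le (by omega)
      rw [Real.exp_neg, ← div_eq_mul_inv, div_le_div_iff₀ hexp (by positivity)]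
      calc s ^ m * c ^ m ≤ s ^ (2 * m) * c ^ m := by gcongr
        _ = c ^ m * s ^ (2 * m) := by ring
        _ ≤ Real.exp (c * s ^ 2) * m.factorial := h2'
        _ = (m.factorial : ℝ) * Real.exp (c * s ^ 2) := by ring
    calc (1 + s) ^ m * Real.exp (-(c * s ^ 2)) ≤ (2 * s) ^ m * Real.exp (-(c * s ^ 2)) :=
          mul_le_mul_of_nonneg_right h1 (Real.exp_pos _).le
      _ = 2 ^ m * (s ^ m * Real.exp (-(c * s ^ 2))) := by rw [mul_pow]; ring
      _ ≤ 2 ^ m * ((m.factorial : ℝ) / c ^ m) := mul_le_mul_of_nonneg_left h3 (by positivity)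
      _ ≤ 2 ^ m * (1 + (m.factorial : ℝ) / c ^ m) :=
          mul_le_mul_of_nonneg_left (by linarith) (by positivity)

/-- **Polynomially weighted Gaussians are integrable on `ℂ^Λ`**: `(1+‖φ‖)^k e^{-c‖φ‖²}` is
integrable for `c > 0` (Lebesgue measure on `ℂ^Λ ≅ ℝ^{2|Λ|}`). [folklore] -/
theorem integrable_one_add_norm_pow_mul_exp_neg (hc : 0 < c) (k : ℕ) :
    Integrable (fun φ : Λ → ℂ => (1 + ‖φ‖) ^ k * Real.exp (-(c * ‖φ‖ ^ 2))) := by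
  -- dominate by `K (1+‖φ‖)^{-r}`, `r = finrank + 1`
  obtain ⟨K, hK, hKle⟩ := one_add_pow_mul_exp_neg_le hc (k + (Module.finrank ℝ (Λ → ℂ) + 1))
  set r : ℕ := Module.finrank ℝ (Λ → ℂ) + 1 with hr
  have hint : Integrable (fun φ : Λ → ℂ => K * (1 + ‖φ‖) ^ (-(r : ℝ))) := by
    refine (integrable_one_add_norm ?_).const_mul K
    rw [hr]; push_cast; linarith
  refine hint.mono' (by fun_prop) (Eventually.of_forall fun φ => ?_)
  have hpos : 0 < 1 + ‖φ‖ := by positivity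
  rw [Real.norm_eq_abs, abs_of_nonneg (by positivity)]
  have h1 := hKle ‖φ‖ (norm_nonneg _)
  rw [pow_add] at h1
  rw [Real.rpow_neg hpos.le, Real.rpow_natCast, ← div_eq_mul_inv, le_div_iff₀ (pow_pos hpos r)]
  calc (1 + ‖φ‖) ^ k * Real.exp (-(c * ‖φ‖ ^ 2)) * (1 + ‖φ‖) ^ r
      = (1 + ‖φ‖) ^ k * (1 + ‖φ‖) ^ r * Real.exp (-(c * ‖φ‖ ^ 2)) := by ring
    _ ≤ K := h1

/-- **Domination principle**: a measurable `F` with `‖F(φ)‖ ≤ M(1+‖φ‖)^k` times the Gaussian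
weight of a matrix with positive Hermitian part (`Re φBφ̄ ≥ cΣ|φ_x|²`, `c > 0`) is integrable.
[cite: BrydgesImbrieSlade2009, §2.1 ("We assume that C has positive Hermitian part")] -/
theorem integrable_mul_gaussWeight (hc : 0 < c) (hB : ∀ φ, c * ∑ x, ‖φ x‖ ^ 2 ≤ (quadForm B φ).re)
    {F : (Λ → ℂ) → ℂ} (hF : AEStronglyMeasurable F volume) {M : ℝ} {k : ℕ}
    (hbound : ∀ φ, ‖F φ‖ ≤ M * (1 + ‖φ‖) ^ k) :
    Integrable fun φ => F φ * gaussWeight B φ := by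
  have hcont : Continuous (gaussWeight B) := by
    unfold gaussWeight quadForm; fun_prop
  refine Integrable.mono' ((integrable_one_add_norm_pow_mul_exp_neg hc k).const_mul M)
    (hF.mul hcont.aestronglyMeasurable) (Eventually.of_forall fun φ => ?_)
  rw [norm_mul]
  calc ‖F φ‖ * ‖gaussWeight B φ‖ ≤ M * (1 + ‖φ‖) ^ k * Real.exp (-(c * ‖φ‖ ^ 2)) :=
        mul_le_mul (hbound φ) (norm_gaussWeight_le hc.le hB φ) (norm_nonneg _)
          (le_trans (norm_nonneg _) (hbound φ))
    _ = M * ((1 + ‖φ‖) ^ k * Real.exp (-(c * ‖φ‖ ^ 2))) := by ring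


/-! ### Norm bounds for the gradients -/

/-- `‖(Bφ̄)_x‖ ≤ (Σ_y ‖B_{xy}‖) ‖φ‖`. [folklore] -/
theorem norm_gradPhi_le (B : Matrix Λ Λ ℂ) (φ : Λ → ℂ) (x : Λ) :
    ‖gradPhi B φ x‖ ≤ (∑ y, ‖B x y‖) * ‖φ‖ := by
  rw [gradPhi, Finset.sum_mul]
  refine (norm_sum_le _ _).trans (Finset.sum_le_sum fun y _ => ?_)
  rw [norm_mul, Complex.norm_conj]
  exact mul_le_mul_of_nonneg_left (norm_le_pi_norm φ y) (norm_nonneg _)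

/-- `‖(φB)_x‖ ≤ (Σ_y ‖B_{yx}‖) ‖φ‖`. [folklore] -/
theorem norm_gradPhiBar_le (B : Matrix Λ Λ ℂ) (φ : Λ → ℂ) (x : Λ) :
    ‖gradPhiBar B φ x‖ ≤ (∑ y, ‖B y x‖) * ‖φ‖ := by
  rw [gradPhiBar, Finset.sum_mul]
  refine (norm_sum_le _ _).trans (Finset.sum_le_sum fun y _ => ?_)
  rw [norm_mul, mul_comm]
  exact mul_le_mul_of_nonneg_left (norm_le_pi_norm φ y) (norm_nonneg _)

/-- A crude constant dominating the directional derivatives of `φBφ̄`. [folklore] -/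
def derivConst (B : Matrix Λ Λ ℂ) : ℝ := ∑ x, ((∑ y, ‖B x y‖) + ∑ y, ‖B y x‖)

/-- `K_B ≥ 0`. [folklore] -/
theorem derivConst_nonneg (B : Matrix Λ Λ ℂ) : 0 ≤ derivConst B :=
  Finset.sum_nonneg fun _ _ => add_nonneg (Finset.sum_nonneg fun _ _ => norm_nonneg _)
    (Finset.sum_nonneg fun _ _ => norm_nonneg _)

/-- `‖∂_v(φBφ̄)‖ ≤ K_B ‖v‖ ‖φ‖`. [folklore] -/
theorem norm_quadFormDeriv_apply_le (B : Matrix Λ Λ ℂ) (φ v : Λ → ℂ) :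
    ‖quadFormDeriv B φ v‖ ≤ derivConst B * ‖v‖ * ‖φ‖ := by
  rw [quadFormDeriv_apply, derivConst, Finset.sum_mul, Finset.sum_mul]
  refine (norm_sum_le _ _).trans (Finset.sum_le_sum fun x _ => ?_)
  refine (norm_add_le _ _).trans ?_
  rw [norm_mul, norm_mul, Complex.norm_conj, add_mul, add_mul]
  refine add_le_add ?_ ?_
  · calc ‖v x‖ * ‖gradPhi B φ x‖ ≤ ‖v‖ * ((∑ y, ‖B x y‖) * ‖φ‖) :=
        mul_le_mul (norm_le_pi_norm v x) (norm_gradPhi_le B φ x) (norm_nonneg _) (norm_nonneg _)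
      _ = (∑ y, ‖B x y‖) * ‖v‖ * ‖φ‖ := by ring
  · calc ‖v x‖ * ‖gradPhiBar B φ x‖ ≤ ‖v‖ * ((∑ y, ‖B y x‖) * ‖φ‖) :=
        mul_le_mul (norm_le_pi_norm v x) (norm_gradPhiBar_le B φ x) (norm_nonneg _) (norm_nonneg _)
      _ = (∑ y, ‖B y x‖) * ‖v‖ * ‖φ‖ := by ring

/-! ### Integration by parts against the Gaussian weight -/

/-- **Integration by parts on `ℂ^Λ`** (no boundary terms: polynomially bounded `F` against a
Gaussian with positive Hermitian part): `∫ F ∂_v(φBφ̄) e^{-φBφ̄} = ∫ (∂_vF) e^{-φBφ̄}` for every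
real direction `v`. This is the standard integration by parts behind Lemma 2.2 of the source
("we can use standard integration by parts to move the derivative from one factor to the other").
[cite: BrydgesImbrieSlade2009, Lemma 2.2 (proof)] -/
theorem integral_mul_quadFormDeriv_mul_gaussWeight (hc : 0 < c)
    (hB : ∀ φ, c * ∑ x, ‖φ x‖ ^ 2 ≤ (quadForm B φ).re) {F : (Λ → ℂ) → ℂ}
    (hFd : Differentiable ℝ F) (v : Λ → ℂ) {M : ℝ} {k : ℕ} (hF : ∀ φ, ‖F φ‖ ≤ M * (1 + ‖φ‖) ^ k)
    (hF' : ∀ φ, ‖fderiv ℝ F φ v‖ ≤ M * (1 + ‖φ‖) ^ k) :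
    ∫ φ, F φ * quadFormDeriv B φ v * gaussWeight B φ = ∫ φ, fderiv ℝ F φ v * gaussWeight B φ := by
  have hcontF : Continuous F := hFd.continuous
  have hM : 0 ≤ M := by
    have := (norm_nonneg _).trans (hF 0)
    simpa using this
  -- the three integrability conditions of the Mathlib lemma
  have h1 : Integrable (fun φ => fderiv ℝ F φ v * gaussWeight B φ) :=
    integrable_mul_gaussWeight hc hB (measurable_fderiv_apply_const ℝ F v).aestronglyMeasurable hF'
  have h2 : Integrable (fun φ => F φ * fderiv ℝ (gaussWeight B) φ v) := by
    have h2' : Integrable (fun φ => (-(F φ * quadFormDeriv B φ v)) * gaussWeight B φ) := by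
      refine integrable_mul_gaussWeight hc hB ?_ (M := M * (derivConst B * ‖v‖)) (k := k + 1)
        fun φ => ?_
      · have : Continuous fun φ => -(F φ * quadFormDeriv B φ v) := by
          refine (hcontF.mul ?_).neg
          simp only [quadFormDeriv_apply, gradPhi, gradPhiBar]
          fun_prop
        exact this.aestronglyMeasurable
      · rw [norm_neg, norm_mul, pow_succ]
        calc ‖F φ‖ * ‖quadFormDeriv B φ v‖ ≤ (M * (1 + ‖φ‖) ^ k) * (derivConst B * ‖v‖ * ‖φ‖) :=
              mul_le_mul (hF φ) (norm_quadFormDeriv_apply_le B φ v) (norm_nonneg _) (by positivity)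
          _ ≤ (M * (1 + ‖φ‖) ^ k) * (derivConst B * ‖v‖ * (1 + ‖φ‖)) := by
              have := derivConst_nonneg B
              gcongr; linarith [norm_nonneg φ]
          _ = M * (derivConst B * ‖v‖) * ((1 + ‖φ‖) ^ k * (1 + ‖φ‖)) := by ring
    refine h2'.congr (Eventually.of_forall fun φ => ?_)
    simp only [fderiv_gaussWeight_apply]; ring
  have h3 : Integrable (fun φ => F φ * gaussWeight B φ) :=
    integrable_mul_gaussWeight hc hB hcontF.aestronglyMeasurable hF
  have hibp := integral_mul_fderiv_eq_neg_fderiv_mul_of_integrable (μ := volume) h1 h2 h3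
    (fun φ _ => hFd φ) (fun φ _ => (hasFDerivAt_gaussWeight B φ).differentiableAt)
  -- `∫ F ∂_v g = -∫ F (∂_vQ) g`
  have hlhs : ∫ φ, F φ * fderiv ℝ (gaussWeight B) φ v = -∫ φ, F φ * quadFormDeriv B φ v * gaussWeight B φ := by
    rw [← integral_neg]
    refine integral_congr_ae (Eventually.of_forall fun φ => ?_)
    simp only [fderiv_gaussWeight_apply]; ring
  rw [hlhs] at hibp
  have := neg_injective hibp
  exact this

/-- The unit vector `e_x ∈ ℂ^Λ`. [folklore] -/
def unitVec [DecidableEq Λ] (x : Λ) : Λ → ℂ := Pi.single x 1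

/-- `∂_{e_x}(φBφ̄) = (Bφ̄)_x + (φB)_x`. [folklore] -/
theorem quadFormDeriv_unitVec [DecidableEq Λ] (B : Matrix Λ Λ ℂ) (φ : Λ → ℂ) (x : Λ) :
    quadFormDeriv B φ (unitVec x) = gradPhi B φ x + gradPhiBar B φ x := by
  rw [quadFormDeriv_apply, Finset.sum_eq_single x]
  · simp [unitVec]
  · intro y _ hy; simp [unitVec, hy]
  · intro h; exact absurd (Finset.mem_univ x) h

/-- `∂_{ie_x}(φBφ̄) = i(Bφ̄)_x - i(φB)_x`. [folklore] -/
theorem quadFormDeriv_I_smul_unitVec [DecidableEq Λ] (B : Matrix Λ Λ ℂ) (φ : Λ → ℂ) (x : Λ) :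
    quadFormDeriv B φ (I • unitVec x) = I * gradPhi B φ x - I * gradPhiBar B φ x := by
  rw [quadFormDeriv_apply, Finset.sum_eq_single x]
  · simp [unitVec, Complex.conj_I]; ring
  · intro y _ hy; simp [unitVec, hy]
  · intro h; exact absurd (Finset.mem_univ x) h

/-- **`∫ φ_b (Bφ̄)_x e^{-φBφ̄} = δ_{x,b} ∫ e^{-φBφ̄}`** — the Wirtinger form of the integration by
parts (`∂φ_b/∂φ_x = δ`, `∂/∂φ_x = ½(∂_{e_x} - i∂_{ie_x})`).
[cite: BrydgesImbrieSlade2009, Lemma 2.2 (proof, display with A_{x,y}φ̄_y)] -/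
theorem integral_coord_mul_gradPhi_mul_gaussWeight [DecidableEq Λ] (hc : 0 < c)
    (hB : ∀ φ, c * ∑ x, ‖φ x‖ ^ 2 ≤ (quadForm B φ).re) (b x : Λ) :
    ∫ φ, φ b * gradPhi B φ x * gaussWeight B φ =
      (if x = b then 1 else 0) * ∫ φ, gaussWeight B φ := by
  have hFd : Differentiable ℝ (fun φ : Λ → ℂ => φ b) := fun φ => (hasFDerivAt_coord b φ).differentiableAt
  have hF : ∀ φ : Λ → ℂ, ‖φ b‖ ≤ 1 * (1 + ‖φ‖) ^ 1 := fun φ => by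
    rw [one_mul, pow_one]; linarith [norm_le_pi_norm φ b, norm_nonneg φ]
  have hF' : ∀ (v : Λ → ℂ), ‖v‖ ≤ 1 → ∀ φ : Λ → ℂ,
      ‖fderiv ℝ (fun φ : Λ → ℂ => φ b) φ v‖ ≤ 1 * (1 + ‖φ‖) ^ 1 := fun v hv φ => by
    rw [fderiv_coord_apply, one_mul, pow_one]
    linarith [norm_le_pi_norm v b, norm_nonneg φ]
  have hnorm1 : ‖unitVec (Λ := Λ) x‖ ≤ 1 := by
    refine (pi_norm_le_iff_of_nonneg zero_le_one).2 fun y => ?_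
    by_cases hy : y = x
    · subst hy; simp [unitVec]
    · simp [unitVec, hy]
  have hnorm2 : ‖I • unitVec (Λ := Λ) x‖ ≤ 1 := by
    rw [norm_smul, Complex.norm_I, one_mul]; exact hnorm1
  -- IBP in the two real directions `e_x`, `ie_x`
  have h1 := integral_mul_quadFormDeriv_mul_gaussWeight hc hB hFd (unitVec x) hF (hF' _ hnorm1)
  have h2 := integral_mul_quadFormDeriv_mul_gaussWeight hc hB hFd (I • unitVec x) hF (hF' _ hnorm2)
  simp only [fderiv_coord_apply, quadFormDeriv_unitVec] at h1
  simp only [fderiv_coord_apply, quadFormDeriv_I_smul_unitVec, Pi.smul_apply, smul_eq_mul] at h2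
  -- integrability of the two pieces
  have hintP : Integrable fun φ : Λ → ℂ => φ b * gradPhi B φ x * gaussWeight B φ := by
    refine integrable_mul_gaussWeight hc hB (by unfold gradPhi; fun_prop) (M := ∑ y, ‖B x y‖) (k := 2)
      fun φ => ?_
    rw [norm_mul]
    calc ‖φ b‖ * ‖gradPhi B φ x‖ ≤ ‖φ‖ * ((∑ y, ‖B x y‖) * ‖φ‖) :=
          mul_le_mul (norm_le_pi_norm φ b) (norm_gradPhi_le B φ x) (norm_nonneg _) (norm_nonneg _)
      _ ≤ (∑ y, ‖B x y‖) * (1 + ‖φ‖) ^ 2 := by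
          have : 0 ≤ ∑ y, ‖B x y‖ := Finset.sum_nonneg fun _ _ => norm_nonneg _
          nlinarith [norm_nonneg φ]
  have hintR : Integrable fun φ : Λ → ℂ => φ b * gradPhiBar B φ x * gaussWeight B φ := by
    refine integrable_mul_gaussWeight hc hB (by unfold gradPhiBar; fun_prop) (M := ∑ y, ‖B y x‖)
      (k := 2) fun φ => ?_
    rw [norm_mul]
    calc ‖φ b‖ * ‖gradPhiBar B φ x‖ ≤ ‖φ‖ * ((∑ y, ‖B y x‖) * ‖φ‖) :=
          mul_le_mul (norm_le_pi_norm φ b) (norm_gradPhiBar_le B φ x) (norm_nonneg _) (norm_nonneg _)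
      _ ≤ (∑ y, ‖B y x‖) * (1 + ‖φ‖) ^ 2 := by
          have : 0 ≤ ∑ y, ‖B y x‖ := Finset.sum_nonneg fun _ _ => norm_nonneg _
          nlinarith [norm_nonneg φ]
  -- rewrite `h1`, `h2` as linear relations between `P = ∫ φ_b (Bφ̄)_x g` and `R = ∫ φ_b (φB)_x g`
  have h1' : (∫ φ : Λ → ℂ, φ b * gradPhi B φ x * gaussWeight B φ) +
      ∫ φ : Λ → ℂ, φ b * gradPhiBar B φ x * gaussWeight B φ =
      ∫ φ : Λ → ℂ, unitVec x b * gaussWeight B φ := by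
    rw [← h1, ← integral_add hintP hintR]
    refine integral_congr_ae (Eventually.of_forall fun φ => ?_); simp only; ring
  have h2' : I * ((∫ φ : Λ → ℂ, φ b * gradPhi B φ x * gaussWeight B φ) -
      ∫ φ : Λ → ℂ, φ b * gradPhiBar B φ x * gaussWeight B φ) =
      ∫ φ : Λ → ℂ, I * unitVec x b * gaussWeight B φ := by
    rw [← h2, ← integral_sub hintP hintR, ← integral_const_mul]
    refine integral_congr_ae (Eventually.of_forall fun φ => ?_); simp only; ring
  have hI : (I : ℂ) ≠ 0 := Complex.I_ne_zero
  have h2'' : (∫ φ : Λ → ℂ, φ b * gradPhi B φ x * gaussWeight B φ) -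
      ∫ φ : Λ → ℂ, φ b * gradPhiBar B φ x * gaussWeight B φ =
      ∫ φ : Λ → ℂ, unitVec x b * gaussWeight B φ := by
    have := h2'
    rw [show (fun φ : Λ → ℂ => I * unitVec x b * gaussWeight B φ) =
        fun φ => I * (unitVec x b * gaussWeight B φ) from funext fun φ => by ring,
      integral_const_mul] at this
    exact mul_left_cancel₀ hI this
  have hδ : (unitVec (Λ := Λ) x b : ℂ) = if x = b then 1 else 0 := by
    by_cases h : x = b
    · subst h; simp [unitVec]
    · simp [unitVec, h, Ne.symm h]
  have hsum := congrArg₂ (· + ·) h1' h2''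
  rw [integral_const_mul, hδ] at hsum
  -- `2P = 2δZ`
  have h2P : (2 : ℂ) * ∫ φ : Λ → ℂ, φ b * gradPhi B φ x * gaussWeight B φ =
      2 * ((if x = b then 1 else 0) * ∫ φ : Λ → ℂ, gaussWeight B φ) := by
    linear_combination hsum
  exact mul_left_cancel₀ two_ne_zero h2P


/-! ### The covariance identity `∫ φ̄_a φ_b e^{-φBφ̄} = (B⁻¹)_{a,b} ∫ e^{-φBφ̄}` -/

/-- The (unnormalised) bosonic partition function `Z_B = ∫_{ℂ^Λ} e^{-φBφ̄} dφ` (Lebesgue measure on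
`ℂ^Λ ≅ ℝ^{2|Λ|}`; the source's `Z_C` carries the extra factor `(2i)^{|Λ|}` of `Π dφ̄_x dφ_x`).
[cite: BrydgesImbrieSlade2009, §2.1, eq. defining Z_C and Lemma 2.1] -/
def partitionFn (B : Matrix Λ Λ ℂ) : ℂ := ∫ φ, gaussWeight B φ

/-- The (unnormalised) two-point integral `∫_{ℂ^Λ} φ̄_a φ_b e^{-φBφ̄} dφ`.
[cite: BrydgesImbrieSlade2009, §2.1, eq. (2.11) (∫ φ̄_a φ_b dμ_C = C_{a,b})] -/
def twoPointFn (B : Matrix Λ Λ ℂ) (a b : Λ) : ℂ := ∫ φ, conj (φ a) * φ b * gaussWeight B φ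

/-- Integrability of `φ̄_a φ_b e^{-φBφ̄}`. [folklore] -/
theorem integrable_conjCoord_mul_coord_mul_gaussWeight (hc : 0 < c)
    (hB : ∀ φ, c * ∑ x, ‖φ x‖ ^ 2 ≤ (quadForm B φ).re) (a b : Λ) :
    Integrable fun φ : Λ → ℂ => conj (φ a) * φ b * gaussWeight B φ := by
  refine integrable_mul_gaussWeight hc hB (by fun_prop) (M := 1) (k := 2) fun φ => ?_
  rw [norm_mul, Complex.norm_conj, one_mul]
  calc ‖φ a‖ * ‖φ b‖ ≤ ‖φ‖ * ‖φ‖ :=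
      mul_le_mul (norm_le_pi_norm φ a) (norm_le_pi_norm φ b) (norm_nonneg _) (norm_nonneg _)
    _ ≤ (1 + ‖φ‖) ^ 2 := by nlinarith [norm_nonneg φ]

/-- **`Σ_y B_{x,y} ∫ φ̄_y φ_b e^{-φBφ̄} = δ_{x,b} Z_B`**: the matrix `B` applied to the two-point
integrals gives the identity, times `Z_B` ("`∫ Σ_y A_{x,y} φ̄_y F e^{-φAφ̄}`" with `F = φ_b`).
[cite: BrydgesImbrieSlade2009, Lemma 2.2 (proof) and eq. (2.11)] -/
theorem sum_mul_twoPointFn [DecidableEq Λ] (hc : 0 < c)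
    (hB : ∀ φ, c * ∑ x, ‖φ x‖ ^ 2 ≤ (quadForm B φ).re) (x b : Λ) :
    ∑ y, B x y * twoPointFn B y b = (if x = b then 1 else 0) * partitionFn B := by
  rw [partitionFn, ← integral_coord_mul_gradPhi_mul_gaussWeight hc hB b x]
  simp only [twoPointFn]
  have h1 : ∀ y, B x y * ∫ φ : Λ → ℂ, conj (φ y) * φ b * gaussWeight B φ =
      ∫ φ : Λ → ℂ, B x y * (conj (φ y) * φ b * gaussWeight B φ) := fun y =>
    (integral_const_mul _ _).symm
  simp_rw [h1]
  rw [← integral_finsetSum _ fun y _ =>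
    (integrable_conjCoord_mul_coord_mul_gaussWeight hc hB y b).const_mul (B x y)]
  refine integral_congr_ae (Eventually.of_forall fun φ => ?_)
  simp only [gradPhi, Finset.mul_sum, Finset.sum_mul]
  exact Finset.sum_congr rfl fun y _ => by ring

/-- A matrix with positive Hermitian part (`Re φBφ̄ ≥ cΣ|φ_x|²`, `c > 0`) is invertible: if `Bw = 0`
then `φ = w̄` has `φBφ̄ = 0`. [cite: BrydgesImbrieSlade2009, §2.1 ("Let A = C⁻¹")] -/
theorem isUnit_of_re_quadForm_ge [DecidableEq Λ] (hc : 0 < c)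
    (hB : ∀ φ, c * ∑ x, ‖φ x‖ ^ 2 ≤ (quadForm B φ).re) : IsUnit B := by
  rw [← Matrix.mulVec_injective_iff_isUnit]
  intro w₁ w₂ h
  rw [← sub_eq_zero] at h ⊢
  rw [← Matrix.mulVec_sub] at h
  set w := w₁ - w₂ with hw
  -- `φ := w̄`
  have hq : quadForm B (fun x => conj (w x)) = 0 := by
    rw [quadForm_eq_sum_gradPhi]
    refine Finset.sum_eq_zero fun x _ => ?_
    have hx : gradPhi B (fun x => conj (w x)) x = (B.mulVec w) x := by
      simp [gradPhi, Matrix.mulVec, dotProduct]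
    rw [hx, h]; simp
  have h2 := hB fun x => conj (w x)
  rw [hq, Complex.zero_re] at h2
  have h3 : ∑ x, ‖conj (w x)‖ ^ 2 ≤ 0 := by
    by_contra h4
    have h5 : 0 < ∑ x, ‖conj (w x)‖ ^ 2 := lt_of_not_ge h4
    nlinarith [mul_pos hc h5]
  have h4 : ∀ x, ‖conj (w x)‖ ^ 2 = 0 := fun x =>
    le_antisymm (le_trans (Finset.single_le_sum (f := fun y => ‖conj (w y)‖ ^ 2)
      (fun y _ => sq_nonneg _) (Finset.mem_univ x)) h3) (sq_nonneg _)
  funext x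
  have := h4 x
  rw [Complex.norm_conj, sq_eq_zero_iff, norm_eq_zero] at this
  simpa [hw] using this

/-- **The covariance identity**: for `B` with positive Hermitian part,
`∫_{ℂ^Λ} φ̄_a φ_b e^{-φBφ̄} dφ = (B⁻¹)_{a,b} ∫_{ℂ^Λ} e^{-φBφ̄} dφ`, i.e. `∫ φ̄_a φ_b dμ_C = C_{a,b}`
with `C = B⁻¹` once `Z_B ≠ 0` (BIS09, (2.11); a special case of Wick's theorem, proved — as in the
source — by integration by parts, here WITHOUT evaluating `Z_B`).
[cite: BrydgesImbrieSlade2009, §2.1, eq. (2.11) and Lemma 2.2] -/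
theorem twoPointFn_eq [DecidableEq Λ] (hc : 0 < c)
    (hB : ∀ φ, c * ∑ x, ‖φ x‖ ^ 2 ≤ (quadForm B φ).re) (a b : Λ) :
    twoPointFn B a b = B⁻¹ a b * partitionFn B := by
  set T : Matrix Λ Λ ℂ := Matrix.of fun y b' => twoPointFn B y b' with hT
  have hBT : B * T = partitionFn B • (1 : Matrix Λ Λ ℂ) := by
    ext x b'
    rw [Matrix.mul_apply, Matrix.smul_apply, Matrix.one_apply, smul_eq_mul, mul_comm]
    simp only [hT, Matrix.of_apply]
    rw [sum_mul_twoPointFn hc hB x b']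
  have hdet : IsUnit B.det := (Matrix.isUnit_iff_isUnit_det B).1 (isUnit_of_re_quadForm_ge hc hB)
  have hT' : T = partitionFn B • B⁻¹ := by
    calc T = B⁻¹ * B * T := by rw [Matrix.nonsing_inv_mul _ hdet, one_mul]
      _ = B⁻¹ * (partitionFn B • (1 : Matrix Λ Λ ℂ)) := by rw [mul_assoc, hBT]
      _ = partitionFn B • B⁻¹ := by rw [Matrix.mul_smul, mul_one]
  have := congrFun (congrFun hT' a) b
  simp only [hT, Matrix.of_apply, Matrix.smul_apply, smul_eq_mul] at this
  rw [this, mul_comm]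

end Boson

end CTWSAW

end Literature.Barriers.CriticalPhenomena
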